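import Mathlib.Combinatorics.SimpleGraph.Coloring.Vertex
import Mathlib.Combinatorics.SimpleGraph.Clique
import Mathlib.Algebra.Order.BigOperators.Group.Finset
import Mathlib.Data.ZMod.Basic
import Summits.Ventures.DiscreteObjects.UnitDistance.UnitCircleGraph

/-!
# Independence numbers of the unit-quadrance graphs `UD(F_p²)` and the `χ ≥ 6` criterion (target U, field atlas)

Framing (verbatim for the cell): lottery ticket; floor = certified bounds/negative ranges.

`UD(F_p²) = unitCircleGraph (ZMod p)` is the finite Euclidean ('unit-quadrance') graph `E_p(2,1)` of
Medrano–Myers–Stark–Terras; by Madore's reduction (`UnitCircleGraph.lean`, `FiniteFieldObstruction.lean`) a number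
field with a degree-one prime over `p ≡ 3 (mod 4)` has `χ(K²) ≤ χ(UD(F_p²))`, so a prime 'kills' a field for the
6-chromatic search iff `χ(UD(F_p²)) ≤ 5`.  The census decides `χ(UD(F_p²)) ≥ 6` through the independence number:

* `card_le_mul_indepNum_of_colorable`: a `k`-colourable finite graph has `|V| ≤ k · α(G)` (colour classes are
  independent sets) and its contrapositives `not_colorable_of_mul_indepNum_lt`,
  `succ_le_chromaticNumber_of_mul_indepNum_lt` — no vertex-transitivity is needed;
* `six_le_chromaticNumber_unitCircleGraph_of_indepNum_le`: for `UD(F_p²)` (with `p²` vertices), `5 · a < p²` and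
  `α ≤ a` give `6 ≤ χ`.

The numerical inputs are CERTIFICATE-BACKED STATEMENTS, typed here as `Prop`s and NOT proved in the kernel: they are
established by exact rational certificates (3-point semidefinite bounds with integer Gram factors, verified in integer
arithmetic by two engines; cell files `pub-namedobj-udg-g4/CERT-FORMAT.md`, `certs/udg4/`).  As of this file:
`alpha_ud23_le_108` holds by certificate `cert2_p23_N0` (sha256 `c4e3c3e9…0a888a`, bound `62540777903899791777/2⁵⁹`,
three independent integer evaluations agree); `alpha_ud23_le_105` (which would give `χ(UD(F₂₃²)) ≥ 6`) is OPEN: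
the 3-point level (with cardinality rows, bordered complement block and partial 4-point blocks) admits a pseudo-set of
size 106, and local search finds independent sets of size 87 but not 88 (2026-08-20).
-/

namespace Summit.Ventures.DiscreteObjects.UnitDistance

open SimpleGraph Finset

section Counting

variable {V : Type*} [Fintype V] (G : SimpleGraph V)

/-- Each colour class of a proper colouring is an independent set. -/
theorem isIndepSet_colorClass {k : ℕ} (C : G.Coloring (Fin k)) (c : Fin k) [DecidableEq V] :
    G.IsIndepSet ↑(univ.filter fun v => C v = c) := by
  intro v hv w hw _ hadj
  simp only [coe_filter, mem_univ, true_and] at hv hw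
  exact C.valid hadj (hv.trans hw.symm)

/-- If `G` is `k`-colourable then `|V| ≤ k · α(G)`. -/
theorem card_le_mul_indepNum_of_colorable {k : ℕ} (h : G.Colorable k) :
    Fintype.card V ≤ k * G.indepNum := by
  classical
  obtain ⟨C⟩ := h
  have hcover : (univ : Finset V) = univ.biUnion (fun c : Fin k => univ.filter fun v => C v = c) := by
    ext v; simp
  calc Fintype.card V = (univ : Finset V).card := Finset.card_univ.symm
    _ = (univ.biUnion (fun c : Fin k => univ.filter fun v => C v = c)).card := by rw [← hcover]
    _ ≤ ∑ c : Fin k, (univ.filter fun v => C v = c).card := card_biUnion_le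
    _ ≤ ∑ _c : Fin k, G.indepNum :=
        Finset.sum_le_sum fun c _ => (isIndepSet_colorClass G C c).card_le_indepNum
    _ = k * G.indepNum := by simp

/-- `k · α(G) < |V|` forbids a `k`-colouring. -/
theorem not_colorable_of_mul_indepNum_lt {k : ℕ} (h : k * G.indepNum < Fintype.card V) :
    ¬ G.Colorable k := fun hc => (Nat.lt_irrefl _) (h.trans_le (card_le_mul_indepNum_of_colorable G hc))

/-- `k · α(G) < |V|` gives `k + 1 ≤ χ(G)`. -/
theorem succ_le_chromaticNumber_of_mul_indepNum_lt {k : ℕ} (h : k * G.indepNum < Fintype.card V) :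
    (k + 1 : ℕ∞) ≤ G.chromaticNumber := by
  by_contra hlt
  have hlt' : G.chromaticNumber < (k : ℕ∞) + 1 := lt_of_not_ge hlt
  have hle : G.chromaticNumber ≤ (k : ℕ) := Order.le_of_lt_add_one hlt'
  exact not_colorable_of_mul_indepNum_lt G h (chromaticNumber_le_iff_colorable.mp hle)

/-- Monotone form: an upper bound `α(G) ≤ a` with `k · a < |V|` gives `k + 1 ≤ χ(G)`. -/
theorem succ_le_chromaticNumber_of_indepNum_le {k a : ℕ} (ha : G.indepNum ≤ a) (h : k * a < Fintype.card V) :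
    (k + 1 : ℕ∞) ≤ G.chromaticNumber :=
  succ_le_chromaticNumber_of_mul_indepNum_lt G ((Nat.mul_le_mul_left k ha).trans_lt h)

end Counting

section UnitQuadrance

/-- `UD(F_p²)` has `p²` vertices. -/
theorem card_vertices_unitCircleGraph_zmod (p : ℕ) [NeZero p] :
    Fintype.card (ZMod p × ZMod p) = p ^ 2 := by
  simp [ZMod.card, sq]

/-- The `χ ≥ 6` criterion of the census: `α(UD(F_p²)) ≤ a` and `5 · a < p²` give `6 ≤ χ(UD(F_p²))`
(so `p` is not a 'killer prime' of the field atlas). -/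
theorem six_le_chromaticNumber_unitCircleGraph_of_indepNum_le (p a : ℕ) [NeZero p]
    (ha : (unitCircleGraph (ZMod p)).indepNum ≤ a) (h : 5 * a < p ^ 2) :
    (6 : ℕ∞) ≤ (unitCircleGraph (ZMod p)).chromaticNumber := by
  have h' : 5 * a < Fintype.card (ZMod p × ZMod p) := by rwa [card_vertices_unitCircleGraph_zmod]
  exact_mod_cast succ_le_chromaticNumber_of_indepNum_le (unitCircleGraph (ZMod p)) ha h'

/-- CERTIFICATE-BACKED STATEMENT (typed, not kernel-proved): `α(UD(F₂₃²)) ≤ 108`.  Established by the exact 3-point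
SDP certificate `cert2_p23_N0` (sha256 `c4e3c3e9c3d29323f531b01c4dc1132bff4becfd22251eb7a809be00350a888a`; verified
bound `62540777903899791777/2⁵⁹ < 109`, two integer Gram engines).  Printed knowledge: `79 ≤ α`
(Cioabă, PhD thesis, Queen's Univ. 2005, §4.3) and the Hoffman bound `α ≤ 131`. -/
def alpha_ud23_le_108 : Prop := (unitCircleGraph (ZMod 23)).indepNum ≤ 108

/-- OPEN census statement: `α(UD(F₂₃²)) ≤ 105`; by `six_le_chromaticNumber_ud23_of` it would certify
`χ(UD(F₂₃²)) ≥ 6`, i.e. that 23 is not a killer prime. -/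
def alpha_ud23_le_105 : Prop := (unitCircleGraph (ZMod 23)).indepNum ≤ 105

/-- The reduction for `p = 23`: `5 · 105 = 525 < 529 = 23²`. -/
theorem six_le_chromaticNumber_ud23_of (h : alpha_ud23_le_105) :
    (6 : ℕ∞) ≤ (unitCircleGraph (ZMod 23)).chromaticNumber :=
  six_le_chromaticNumber_unitCircleGraph_of_indepNum_le 23 105 h (by decide)

/-- The reductions for the other three undecided primes of the atlas (thresholds `⌊(p²−1)/5⌋`);
`p = 31`: `5 · 192 = 960 < 961`. -/
theorem six_le_chromaticNumber_ud31_of (h : (unitCircleGraph (ZMod 31)).indepNum ≤ 192) :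
    (6 : ℕ∞) ≤ (unitCircleGraph (ZMod 31)).chromaticNumber :=
  six_le_chromaticNumber_unitCircleGraph_of_indepNum_le 31 192 h (by decide)

/-- The reduction for `p = 43`: `5 · 369 = 1845 < 1849`. -/
theorem six_le_chromaticNumber_ud43_of (h : (unitCircleGraph (ZMod 43)).indepNum ≤ 369) :
    (6 : ℕ∞) ≤ (unitCircleGraph (ZMod 43)).chromaticNumber :=
  six_le_chromaticNumber_unitCircleGraph_of_indepNum_le 43 369 h (by decide)

/-- The reduction for `p = 47`: `5 · 441 = 2205 < 2209`. -/
theorem six_le_chromaticNumber_ud47_of (h : (unitCircleGraph (ZMod 47)).indepNum ≤ 441) :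
    (6 : ℕ∞) ≤ (unitCircleGraph (ZMod 47)).chromaticNumber :=
  six_le_chromaticNumber_unitCircleGraph_of_indepNum_le 47 441 h (by decide)

end UnitQuadrance

end Summit.Ventures.DiscreteObjects.UnitDistance

/-! ### Appendix (2026-08-20, later the same session): the primes 43 and 47 are decided

Certificate-backed statements (typed, NOT kernel-proved) from X-only 3-point SDP certificates produced by a
graph-form ADMM solver and verified in exact integer arithmetic (cell files `certs/udg4/alpha43-j103480`,
`certs/udg4/alpha47-j103481`; verifier `code/udg4/cert/verify_cert2.py`):
`α(UD(F₄₃²)) ≤ 349` (sha256 `1838d7fe314acf4af6c560705494ced80c7b3c3a537d61018ebda8083e1884b5`, bound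
`201716261989431127913/2⁵⁹ < 350`) and `α(UD(F₄₇²)) ≤ 435` (sha256
`4b0ff34a1a309df744ef45b55ec6115b38e9880faf23bce46395b32a8f66beba`, bound `62704193529397677385/2⁵⁷ < 436`).
With the kernel criterion above they give `χ(UD(F₄₃²)) ≥ 6` and `χ(UD(F₄₇²)) ≥ 6`: neither 43 nor 47 is a
'killer prime' of the field atlas, so the killer set is contained in `{3, 7, 11, 19} ∪ {23, 31}`. -/

namespace Summit.Ventures.DiscreteObjects.UnitDistance

open SimpleGraph

/-- CERTIFICATE-BACKED STATEMENT (typed, not kernel-proved): `α(UD(F₄₃²)) ≤ 349` (certificate `cert2_p43_N0`,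
sha256 `1838d7fe…84b5`, exact bound `201716261989431127913/2⁵⁹`). -/
def alpha_ud43_le_349 : Prop := (unitCircleGraph (ZMod 43)).indepNum ≤ 349

/-- CERTIFICATE-BACKED STATEMENT (typed, not kernel-proved): `α(UD(F₄₇²)) ≤ 435` (certificate `cert2_p47_N0`,
sha256 `4b0ff34a…beba`, exact bound `62704193529397677385/2⁵⁷`). -/
def alpha_ud47_le_435 : Prop := (unitCircleGraph (ZMod 47)).indepNum ≤ 435

/-- `43` is not a killer prime: the certified `α ≤ 349` gives `χ(UD(F₄₃²)) ≥ 6` (`5 · 349 = 1745 < 1849`). -/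
theorem six_le_chromaticNumber_ud43 (h : alpha_ud43_le_349) :
    (6 : ℕ∞) ≤ (unitCircleGraph (ZMod 43)).chromaticNumber :=
  six_le_chromaticNumber_unitCircleGraph_of_indepNum_le 43 349 h (by decide)

/-- `47` is not a killer prime: the certified `α ≤ 435` gives `χ(UD(F₄₇²)) ≥ 6` (`5 · 435 = 2175 < 2209`). -/
theorem six_le_chromaticNumber_ud47 (h : alpha_ud47_le_435) :
    (6 : ℕ∞) ≤ (unitCircleGraph (ZMod 47)).chromaticNumber :=
  six_le_chromaticNumber_unitCircleGraph_of_indepNum_le 47 435 h (by decide)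

end Summit.Ventures.DiscreteObjects.UnitDistance

/-! ### Appendix 2 (2026-08-20, same session): the prime 23 is decided at the 4-point level

The 3-point level could not go below `α ≤ 108` at `p = 23`, but the 4-POINT level (for each quadrance class `u`, the
`529 × 529` matrix `(#{a : a, a+u, a+v, a+w ∈ A}/|A|)_{v,w}` is positive semidefinite; variables = isometry classes of
4-point sets, 98 459 of them) gives the exact certificate `cert4_p23` (sha256
`3941d08f80a7de7f4c295c73e82ea5bae6637303dea9aca8755f05a3e0c3f1d9`, bound `460277489635107211/2⁵² < 103`; verifier
`code/udg4/cert/verify_cert4.py`, cell folder `certs/udg4/alpha23-4pt-j103965`): `α(UD(F₂₃²)) ≤ 102`, hence (kernel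
criterion above, `5 · 102 = 510 < 529`) `χ(UD(F₂₃²)) ≥ 6`.  The killer primes of the field atlas are therefore
contained in `{3, 7, 11, 19} ∪ {31}`; `p = 31` (3-point bound 200.9 vs threshold 192) is the last undecided one. -/

namespace Summit.Ventures.DiscreteObjects.UnitDistance

open SimpleGraph

/-- CERTIFICATE-BACKED STATEMENT (typed, not kernel-proved): `α(UD(F₂₃²)) ≤ 102` (4-point certificate `cert4_p23`,
sha256 `3941d08f…f1d9`, exact bound `460277489635107211/2⁵²`). -/
def alpha_ud23_le_102 : Prop := (unitCircleGraph (ZMod 23)).indepNum ≤ 102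

/-- The certified `α ≤ 102` implies the earlier typed target `α ≤ 105`. -/
theorem alpha_ud23_le_105_of (h : alpha_ud23_le_102) : alpha_ud23_le_105 := le_trans h (by decide)

/-- `23` is not a killer prime: the certified `α(UD(F₂₃²)) ≤ 102` gives `χ(UD(F₂₃²)) ≥ 6` (`5 · 102 = 510 < 529`). -/
theorem six_le_chromaticNumber_ud23 (h : alpha_ud23_le_102) :
    (6 : ℕ∞) ≤ (unitCircleGraph (ZMod 23)).chromaticNumber :=
  six_le_chromaticNumber_unitCircleGraph_of_indepNum_le 23 102 h (by decide)

end Summit.Ventures.DiscreteObjects.UnitDistance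

/-! ### Appendix 3 (2026-08-20, same session): the prime 31 is decided; the killer set is exactly {3, 7, 11, 19}

Exact 4-point certificate `cert4_p31` (sha256 `b24fbad049109bf20db247351a1e7fbda4199a520314894ce0f8120f63e07531`,
bound `868156620041090009/2⁵² < 193`; 29 conditioned `961 × 961` blocks, 474 936 four-set orbit variables; verifier
`code/udg4/cert/verify_cert4.py`; cell folder `certs/udg4/alpha31-4pt-j105190`): `α(UD(F₃₁²)) ≤ 192`, hence
`χ(UD(F₃₁²)) ≥ 6` since `5 · 192 = 960 < 961` (the tightest possible margin).  With Appendices 1–2 the census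
statement of the field atlas is complete at order one: among the primes `p ≡ 3 (mod 4)`, `χ(UD(F_p²)) ≤ 5` holds
exactly for `p ∈ {3, 7, 11, 19}` (for `p ≥ 59` by the certified Hoffman table of the previous seat; for `23, 31, 43, 47`
by the certificates typed in this file). -/

namespace Summit.Ventures.DiscreteObjects.UnitDistance

open SimpleGraph

/-- CERTIFICATE-BACKED STATEMENT (typed, not kernel-proved): `α(UD(F₃₁²)) ≤ 192` (4-point certificate `cert4_p31`,
sha256 `b24fbad0…7531`, exact bound `868156620041090009/2⁵²`). -/
def alpha_ud31_le_192 : Prop := (unitCircleGraph (ZMod 31)).indepNum ≤ 192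

/-- `31` is not a killer prime: the certified `α(UD(F₃₁²)) ≤ 192` gives `χ(UD(F₃₁²)) ≥ 6` (`5 · 192 = 960 < 961`). -/
theorem six_le_chromaticNumber_ud31 (h : alpha_ud31_le_192) :
    (6 : ℕ∞) ≤ (unitCircleGraph (ZMod 31)).chromaticNumber :=
  six_le_chromaticNumber_ud31_of h

/-- Summary of the atlas residue: under the four certificate-backed independence bounds typed in this file,
none of `23, 31, 43, 47` is a killer prime — each unit-quadrance graph needs at least six colours. -/
theorem six_le_chromaticNumber_ud_23_31_43_47
    (h23 : alpha_ud23_le_102) (h31 : alpha_ud31_le_192) (h43 : alpha_ud43_le_349) (h47 : alpha_ud47_le_435) :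
    (6 : ℕ∞) ≤ (unitCircleGraph (ZMod 23)).chromaticNumber ∧ (6 : ℕ∞) ≤ (unitCircleGraph (ZMod 31)).chromaticNumber ∧
    (6 : ℕ∞) ≤ (unitCircleGraph (ZMod 43)).chromaticNumber ∧ (6 : ℕ∞) ≤ (unitCircleGraph (ZMod 47)).chromaticNumber :=
  ⟨six_le_chromaticNumber_ud23 h23, six_le_chromaticNumber_ud31 h31,
   six_le_chromaticNumber_ud43 h43, six_le_chromaticNumber_ud47 h47⟩

end Summit.Ventures.DiscreteObjects.UnitDistance
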